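import Summits.QuantumFields.BalabanUV.T4Continuum.Support.TorusSmallFieldGlobalGauge
import HarnessLib

/-!
# TorusSmallFieldGlobalGaugeSharpPrep — THE WITNESS for the sharpness of gen 26's global `exp A` gauge letter: the UNIT-FLUX ABELIAN CONFIGURATION on the `M`-torus
# (one diagonal entry of `U(n)` carries a lattice `U(1)` bundle of first Chern class one) is unitary, `M`-periodic and has ALL PLAQUETTE VARIABLES WITHIN `2π∕M²` OF `1`

Cell `pub-balaban`, rung (B)+1 sub-cell t4, lineage `b2b-balaban-t4-ne7b-p1` (row NE7b OWNER + CRUX PROVER), generation 156; junction census for the road's fork (S-i)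
(`t4/b2b-balaban-t4-ne7-p1-g108/ROAD-G108.md` §4bis NEXT (i)).  Part 1 of 2; part 2 `TorusSmallFieldGlobalGaugeSharp` proves the obstruction and the sharpness
statements (`not_globalGauge_without_sector`, `sector_threshold_lt`).
THE WITNESS ([folklore]).  On `ℤ⁴` with period `M` put `U(x, 1) = D(e^{2πi·r(x)∕M²})`, `r(x) = x₀ mod M`, `U(x, 0) = D(e^{−2πi·x₁∕M})` on the wrap row `r(x) = M − 1` and
`U(x, 0) = 1` elsewhere, `U(x, 2) = U(x, 3) = 1`, where `D(z) = diag(1, …, z, …, 1)` (entry `i₀`).  Every `(0,1)`-plaquette phase sum is EXACTLY `2π∕M²` (the transition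
row included: `−2πx₁∕M + 2π(x₁+1)∕M − 2π(M−1)∕M² = 2π∕M²`), the `(1,0)` ones are `−2π∕M²`, all others vanish.
WHAT ([folklore]; 0 def, 0 sorry; the configuration enters through EQUATIONAL HYPOTHESES `hU : U(x,μ) = D(e^{iθ(x,μ)})`, `hθ0 … hθ3`, the road's style — part 2 instantiates
them).  §1 the one-entry phase matrices `D(z) = diagonal (update 1 i₀ z)`: `phaseMat_mul`, `phaseMat_one`, `det_phaseMat` (`= z`), `phaseMat_conjTranspose`,
`norm_phaseMat_sub_one_le` (`‖D(z) − 1‖ ≤ ‖z − 1‖`, operator norm), `phaseMat_mem_unitary`, `phaseMat_inv`; §2 diagonal phase configurations: `det_bond_of_phaseCfg`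
(`det U(x,μ) = e^{iθ(x,μ)}`), `val_inv_of_phaseCfg`, `isUnitaryCfg_of_phaseCfg`, **`val_hol_plaqWord_of_phaseCfg`** (`U(∂p) = D(e^{i·(plaquette phase sum)})`),
`smallField_of_phaseCfg`; §3 the unit-flux phases: `add_e_apply`, `add_zsmul_e_apply`, **`plaqPhase_zero_one`** (`= 2π∕M²` exactly), `phase_add_e_two_three`,
`abs_plaqPhase_le`, `phase_periodic_mod`, **`isPeriodicCfg_unitFlux`**, **`smallField_unitFlux`** (`SmallField U (2π∕M²)`).
HONEST FRAMING (page 1): an explicit lattice configuration and elementary matrix algebra; nothing of Bałaban's asserted; NE3∕NE7 NOT proved; row NE7b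
(`T4WeightBudget.RelWeightBound`) NOT PRINTED ∕ NOT PROVED; spine count = dagwriter's call; finite T⁴ rung (B)+1 — NOT infinite volume, NOT mass gap, NOT BetaPertH, NOT Clay
(continuum YM on T⁴ ⇐ BetaPertH ∧ nine spine estimates).
-/

set_option autoImplicit false

open scoped BigOperators Matrix Matrix.Norms.L2Operator
open Finset NormedSpace Complex

namespace Summit.QuantumFields.BalabanUV.T4Continuum.TorusSmallFieldGlobalGaugeSharpPrep

open Literature.MathematicalPhysics.QuantumFieldTheory.Balaban1983to89
open B7Prop1Explicit B7Prop2Explicit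
open T4AveragingDeficitWall hiding Site Plane Plaq Bond
open T4AveragingDeficitWallBoundary (IsPeriodicCfg)

noncomputable section

variable {n : Type*} [Fintype n] [DecidableEq n]

/-! ## §1 The one-entry phase matrices `D(z) = diagonal (update 1 i₀ z)` -/

/-- `D(z)·D(w) = D(z·w)`. [folklore] -/
theorem phaseMat_mul (i₀ : n) (z w : ℂ) :
    Matrix.diagonal (Function.update (1 : n → ℂ) i₀ z) * Matrix.diagonal (Function.update (1 : n → ℂ) i₀ w)
      = Matrix.diagonal (Function.update (1 : n → ℂ) i₀ (z * w)) := by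
  rw [Matrix.diagonal_mul_diagonal]
  congr 1
  funext i
  by_cases hi : i = i₀
  · subst hi; simp
  · simp [Function.update_of_ne hi]

omit [Fintype n] in
/-- `D(1) = 1`. [folklore] -/
theorem phaseMat_one (i₀ : n) : Matrix.diagonal (Function.update (1 : n → ℂ) i₀ 1) = 1 := by
  have h : Function.update (1 : n → ℂ) i₀ 1 = 1 := by
    funext i
    by_cases hi : i = i₀
    · subst hi; simp
    · simp [Function.update_of_ne hi]
  rw [h]; exact Matrix.diagonal_one

/-- `det D(z) = z`. [folklore] -/
theorem det_phaseMat (i₀ : n) (z : ℂ) : (Matrix.diagonal (Function.update (1 : n → ℂ) i₀ z)).det = z := by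
  rw [Matrix.det_diagonal, Finset.prod_update_of_mem (Finset.mem_univ i₀)]
  simp

omit [Fintype n] in
/-- `D(z)ᴴ = D(conj z)`. [folklore] -/
theorem phaseMat_conjTranspose (i₀ : n) (z : ℂ) :
    (Matrix.diagonal (Function.update (1 : n → ℂ) i₀ z))ᴴ = Matrix.diagonal (Function.update (1 : n → ℂ) i₀ (starRingEnd ℂ z)) := by
  rw [Matrix.diagonal_conjTranspose]
  congr 1
  funext i
  by_cases hi : i = i₀
  · subst hi; simp
  · simp [Function.update_of_ne hi]

/-- `‖D(z) − 1‖ ≤ ‖z − 1‖` (operator norm). [folklore] -/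
theorem norm_phaseMat_sub_one_le (i₀ : n) (z : ℂ) : ‖Matrix.diagonal (Function.update (1 : n → ℂ) i₀ z) - 1‖ ≤ ‖z - 1‖ := by
  rw [← phaseMat_one i₀, Matrix.diagonal_sub, Matrix.l2_opNorm_diagonal]
  refine (pi_norm_le_iff_of_nonneg (norm_nonneg _)).mpr fun i => ?_
  by_cases hi : i = i₀
  · subst hi; simp
  · simp [Function.update_of_ne hi]

/-- `D(z)` is unitary for `‖z‖ = 1`. [folklore] -/
theorem phaseMat_mem_unitary (i₀ : n) {z : ℂ} (hz : ‖z‖ = 1) :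
    Matrix.diagonal (Function.update (1 : n → ℂ) i₀ z) ∈ unitary (Matrix n n ℂ) := by
  have h1 : starRingEnd ℂ z * z = 1 := by
    rw [Complex.conj_mul', hz]; simp
  have h2 : z * starRingEnd ℂ z = 1 := by
    rw [Complex.mul_conj', hz]; simp
  show _ ∈ Matrix.unitaryGroup n ℂ
  rw [Matrix.mem_unitaryGroup_iff, Matrix.star_eq_conjTranspose, phaseMat_conjTranspose, phaseMat_mul, h2, phaseMat_one]

/-- `D(z)⁻¹ = D(z⁻¹)` (matrix inverse) for `z ≠ 0`. [folklore] -/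
theorem phaseMat_inv (i₀ : n) {z : ℂ} (hz : z ≠ 0) :
    (Matrix.diagonal (Function.update (1 : n → ℂ) i₀ z))⁻¹ = Matrix.diagonal (Function.update (1 : n → ℂ) i₀ z⁻¹) := by
  apply Matrix.inv_eq_left_inv
  rw [phaseMat_mul, inv_mul_cancel₀ hz, phaseMat_one]

/-! ## §2 Diagonal phase configurations `U(x, μ) = D(e^{iθ(x,μ)})`: determinant, plaquette variables, small-field radius -/

section PhaseCfg

variable {i₀ : n} {θ : Site 4 → Fin 4 → ℝ} {U : Site 4 → Fin 4 → (Matrix n n ℂ)ˣ}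

/-- The bond determinant of a diagonal phase configuration: `det U(x, μ) = e^{iθ(x,μ)}`. [folklore] -/
theorem det_bond_of_phaseCfg (hU : ∀ x μ, ((U x μ : (Matrix n n ℂ)ˣ) : Matrix n n ℂ) = Matrix.diagonal (Function.update (1 : n → ℂ) i₀ (cexp (I * θ x μ))))
    (x : Site 4) (μ : Fin 4) : ((U x μ : (Matrix n n ℂ)ˣ) : Matrix n n ℂ).det = cexp (I * θ x μ) := by
  rw [hU, det_phaseMat]

/-- The inverse bond of a diagonal phase configuration: `U(x, μ)⁻¹ = D(e^{−iθ(x,μ)})`. [folklore] -/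
theorem val_inv_of_phaseCfg (hU : ∀ x μ, ((U x μ : (Matrix n n ℂ)ˣ) : Matrix n n ℂ) = Matrix.diagonal (Function.update (1 : n → ℂ) i₀ (cexp (I * θ x μ))))
    (x : Site 4) (μ : Fin 4) :
    (((U x μ)⁻¹ : (Matrix n n ℂ)ˣ) : Matrix n n ℂ) = Matrix.diagonal (Function.update (1 : n → ℂ) i₀ (cexp (-(I * θ x μ)))) := by
  rw [Matrix.coe_units_inv, hU, phaseMat_inv i₀ (Complex.exp_ne_zero _), Complex.exp_neg]

/-- A diagonal phase configuration is `U(n)`-valued. [folklore] -/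
theorem isUnitaryCfg_of_phaseCfg
    (hU : ∀ x μ, ((U x μ : (Matrix n n ℂ)ˣ) : Matrix n n ℂ) = Matrix.diagonal (Function.update (1 : n → ℂ) i₀ (cexp (I * θ x μ)))) :
    IsUnitaryCfg U := by
  intro x μ
  rw [mem_unitaryUnits, hU]
  exact phaseMat_mem_unitary i₀ (by rw [Complex.norm_exp_I_mul_ofReal])

/-- THE PLAQUETTE VARIABLES of a diagonal phase configuration: `U(∂p) = D(e^{i(θ(x,κ) + θ(x+e_κ,μ) − θ(x+e_μ,κ) − θ(x,μ))})`. [folklore] -/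
theorem val_hol_plaqWord_of_phaseCfg
    (hU : ∀ x μ, ((U x μ : (Matrix n n ℂ)ˣ) : Matrix n n ℂ) = Matrix.diagonal (Function.update (1 : n → ℂ) i₀ (cexp (I * θ x μ))))
    (x : Site 4) (κ μ : Fin 4) :
    ((hol U x (plaqWord κ μ) : (Matrix n n ℂ)ˣ) : Matrix n n ℂ)
      = Matrix.diagonal (Function.update (1 : n → ℂ) i₀ (cexp (I * ((θ x κ + θ (x + e κ) μ - θ (x + e μ) κ - θ x μ : ℝ) : ℂ)))) := by
  rw [← lplaqWord_true, hol_lplaqWord]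
  simp only [stepHol_true, Letter.vec_true, Units.val_mul]
  rw [hU, hU, val_inv_of_phaseCfg hU, val_inv_of_phaseCfg hU, phaseMat_mul, phaseMat_mul, phaseMat_mul]
  congr 2
  rw [← Complex.exp_add, ← Complex.exp_add, ← Complex.exp_add]
  congr 1
  push_cast
  ring

/-- SMALL-FIELD RADIUS of a diagonal phase configuration from a bound `a` on the plaquette phase sums. [folklore] -/
theorem smallField_of_phaseCfg
    (hU : ∀ x μ, ((U x μ : (Matrix n n ℂ)ˣ) : Matrix n n ℂ) = Matrix.diagonal (Function.update (1 : n → ℂ) i₀ (cexp (I * θ x μ))))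
    {a : ℝ} (ha : ∀ (x : Site 4) (κ μ : Fin 4), κ ≠ μ → |θ x κ + θ (x + e κ) μ - θ (x + e μ) κ - θ x μ| ≤ a) :
    SmallField U a := by
  intro x κ μ hκμ
  rw [val_hol_plaqWord_of_phaseCfg hU]
  refine (norm_phaseMat_sub_one_le i₀ _).trans ?_
  refine (Real.norm_exp_I_mul_ofReal_sub_one_le).trans ?_
  rw [Real.norm_eq_abs]
  exact ha x κ μ hκμ

end PhaseCfg

/-! ## §3 The unit-flux phases: `θ(x,1) = 2π·(x₀ mod M)∕M²`, `θ(x,0) = −2π·x₁∕M` on the wrap row `x₀ ≡ M − 1`, `0` otherwise; `θ(x,2) = θ(x,3) = 0` -/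

section UnitFlux

/-- Coordinates of a shifted site: `(x + e_μ)_κ = x_κ + [κ = μ]`. [folklore] -/
theorem add_e_apply (x : Site 4) (μ κ : Fin 4) : (x + e μ : Site 4) κ = x κ + if κ = μ then 1 else 0 := by
  simp [e_apply]

/-- Coordinates of a site shifted by a multiple of `e_μ`: `(x + c•e_μ)_κ = x_κ + c·[κ = μ]`. [folklore] -/
theorem add_zsmul_e_apply (x : Site 4) (c : ℤ) (μ κ : Fin 4) : (x + c • e μ : Site 4) κ = x κ + if κ = μ then c else 0 := by
  simp [e_apply]

variable {M : ℕ} {θ : Site 4 → Fin 4 → ℝ}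
  (hθ0 : ∀ x : Site 4, θ x 0 = if x 0 % (M : ℤ) = (M : ℤ) - 1 then -(2 * Real.pi * ((x 1 : ℤ) : ℝ) / (M : ℝ)) else 0)
  (hθ1 : ∀ x : Site 4, θ x 1 = 2 * Real.pi * (((x 0 % (M : ℤ) : ℤ)) : ℝ) / (M : ℝ) ^ 2)
  (hθ2 : ∀ x : Site 4, θ x 2 = 0) (hθ3 : ∀ x : Site 4, θ x 3 = 0)
include hθ0 hθ1 hθ2 hθ3

omit hθ2 hθ3 in
/-- THE `(0,1)` PLAQUETTE PHASE SUM IS EXACTLY `2π∕M²` — on the bulk rows (`r ↦ r + 1`) and on the wrap row (`x₀ ≡ M − 1`: the transition phase `−2πx₁∕M`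
contributes `2π∕M`, the direction-`1` phase drops from `2π(M−1)∕M²` to `0`). [folklore] -/
theorem plaqPhase_zero_one (hM : 1 ≤ M) (x : Site 4) :
    θ x 0 + θ (x + e 0) 1 - θ (x + e 1) 0 - θ x 1 = 2 * Real.pi / (M : ℝ) ^ 2 := by
  have hM0 : (0 : ℤ) < (M : ℤ) := by exact_mod_cast hM
  have hMr : (0 : ℝ) < (M : ℝ) := by exact_mod_cast hM
  have hr0 : 0 ≤ x 0 % (M : ℤ) := Int.emod_nonneg _ hM0.ne'
  have hrM : x 0 % (M : ℤ) < (M : ℤ) := Int.emod_lt_of_pos _ hM0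
  have h10 : (x + e (1 : Fin 4) : Site 4) 0 = x 0 := by rw [add_e_apply]; simp
  have h11 : (x + e (1 : Fin 4) : Site 4) 1 = x 1 + 1 := by rw [add_e_apply]; simp
  have h00 : (x + e (0 : Fin 4) : Site 4) 0 = x 0 + 1 := by rw [add_e_apply]; simp
  have hmod : (x 0 + 1) % (M : ℤ) = (x 0 % (M : ℤ) + 1) % (M : ℤ) := (Int.emod_add_emod _ _ _).symm
  rw [hθ0 x, hθ1 (x + e 0), hθ0 (x + e 1), hθ1 x, h10, h11, h00, hmod]
  by_cases hw : x 0 % (M : ℤ) = (M : ℤ) - 1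
  · -- the wrap row
    have hnext : (x 0 % (M : ℤ) + 1) % (M : ℤ) = 0 := by rw [hw, sub_add_cancel, Int.emod_self]
    rw [if_pos hw, if_pos hw, hnext, hw]
    push_cast
    field_simp
    ring
  · -- a bulk row
    have hlt : x 0 % (M : ℤ) + 1 < (M : ℤ) := by omega
    have hnext : (x 0 % (M : ℤ) + 1) % (M : ℤ) = x 0 % (M : ℤ) + 1 := Int.emod_eq_of_lt (by omega) hlt
    rw [if_neg hw, if_neg hw, hnext]
    push_cast
    field_simp
    ring

/-- The phases do not see the directions `2`, `3`. [folklore] -/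
theorem phase_add_e_two_three (x : Site 4) (μ : Fin 4) : θ (x + e 2) μ = θ x μ ∧ θ (x + e 3) μ = θ x μ := by
  have h20 : (x + e (2 : Fin 4) : Site 4) 0 = x 0 := by rw [add_e_apply]; simp
  have h21 : (x + e (2 : Fin 4) : Site 4) 1 = x 1 := by rw [add_e_apply]; simp
  have h30 : (x + e (3 : Fin 4) : Site 4) 0 = x 0 := by rw [add_e_apply]; simp
  have h31 : (x + e (3 : Fin 4) : Site 4) 1 = x 1 := by rw [add_e_apply]; simp
  fin_cases μ <;> simp only [Fin.zero_eta, Fin.mk_one, Fin.reduceFinMk, hθ0, hθ1, hθ2, hθ3, h20, h21, h30, h31, and_self]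

/-- ALL PLAQUETTE PHASE SUMS are within `2π∕M²` of `0` (they are `2π∕M²`, `−2π∕M²` or `0`). [folklore] -/
theorem abs_plaqPhase_le (hM : 1 ≤ M) (x : Site 4) (κ μ : Fin 4) (hκμ : κ ≠ μ) :
    |θ x κ + θ (x + e κ) μ - θ (x + e μ) κ - θ x μ| ≤ 2 * Real.pi / (M : ℝ) ^ 2 := by
  have hπ : 0 ≤ 2 * Real.pi / (M : ℝ) ^ 2 := by positivity
  have h01 := plaqPhase_zero_one hθ0 hθ1 hM x
  have h2 := fun μ => (phase_add_e_two_three hθ0 hθ1 hθ2 hθ3 x μ).1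
  have h3 := fun μ => (phase_add_e_two_three hθ0 hθ1 hθ2 hθ3 x μ).2
  fin_cases κ <;> fin_cases μ <;> simp only [Fin.zero_eta, Fin.mk_one, Fin.reduceFinMk] at hκμ ⊢
  all_goals first
    | exact absurd rfl hκμ
    | (rw [abs_le]
       constructor <;>
         linarith [h2 0, h2 1, h2 2, h2 3, h3 0, h3 1, h3 2, h3 3, hθ2 x, hθ3 x, hθ2 (x + e 0), hθ2 (x + e 1), hθ2 (x + e 2), hθ2 (x + e 3),
           hθ3 (x + e 0), hθ3 (x + e 1), hθ3 (x + e 2), hθ3 (x + e 3)])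

/-- THE PHASES ARE `M`-PERIODIC MODULO `2π`: `θ(x + M e_κ, μ) = θ(x, μ) + 2πk` (`k = −1` for the transition phase shifted along `e₁`, else `k = 0`). [folklore] -/
theorem phase_periodic_mod (hM : 1 ≤ M) (x : Site 4) (κ μ : Fin 4) :
    ∃ k : ℤ, θ (x + (M : ℤ) • e κ) μ = θ x μ + 2 * Real.pi * k := by
  have hMr : (M : ℝ) ≠ 0 := (Nat.cast_pos.mpr (Nat.lt_of_lt_of_le Nat.zero_lt_one hM)).ne'
  have hc0 : (x + (M : ℤ) • e κ : Site 4) 0 % (M : ℤ) = x 0 % (M : ℤ) := by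
    rw [add_zsmul_e_apply]
    split_ifs
    · rw [show x 0 + (M : ℤ) = x 0 + (M : ℤ) * 1 by ring, Int.add_mul_emod_self_left]
    · rw [add_zero]
  have hc1 : (x + (M : ℤ) • e κ : Site 4) 1 = x 1 + if (1 : Fin 4) = κ then (M : ℤ) else 0 := add_zsmul_e_apply x M κ 1
  fin_cases μ <;> simp only [Fin.zero_eta, Fin.mk_one, Fin.reduceFinMk]
  · rw [hθ0, hθ0, hc0, hc1]
    by_cases hw : x 0 % (M : ℤ) = (M : ℤ) - 1
    · rw [if_pos hw, if_pos hw]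
      by_cases hκ : (1 : Fin 4) = κ
      · refine ⟨-1, ?_⟩
        rw [if_pos hκ]
        push_cast
        field_simp
        ring
      · refine ⟨0, ?_⟩
        rw [if_neg hκ]
        push_cast
        ring
    · exact ⟨0, by rw [if_neg hw, if_neg hw]; simp⟩
  · refine ⟨0, ?_⟩
    rw [hθ1, hθ1, hc0]
    simp
  · exact ⟨0, by rw [hθ2, hθ2]; simp⟩
  · exact ⟨0, by rw [hθ3, hθ3]; simp⟩

variable {i₀ : n} {U : Site 4 → Fin 4 → (Matrix n n ℂ)ˣ}
  (hU : ∀ x μ, ((U x μ : (Matrix n n ℂ)ˣ) : Matrix n n ℂ) = Matrix.diagonal (Function.update (1 : n → ℂ) i₀ (cexp (I * θ x μ))))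
include hU

/-- THE UNIT-FLUX CONFIGURATION IS `M`-PERIODIC. [folklore] -/
theorem isPeriodicCfg_unitFlux (hM : 1 ≤ M) : IsPeriodicCfg U (M : ℤ) := by
  intro x κ μ
  apply Units.ext
  rw [hU, hU]
  obtain ⟨k, hk⟩ := phase_periodic_mod hθ0 hθ1 hθ2 hθ3 hM x κ μ
  congr 2
  rw [hk, Complex.exp_eq_exp_iff_exists_int]
  exact ⟨k, by push_cast; ring⟩

/-- THE UNIT-FLUX CONFIGURATION IS SMALL-FIELD WITH RADIUS `2π∕M²` (so `card n·M²·η = 2π·card n`, independent of `M`). [folklore] -/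
theorem smallField_unitFlux (hM : 1 ≤ M) : SmallField U (2 * Real.pi / (M : ℝ) ^ 2) :=
  smallField_of_phaseCfg hU (abs_plaqPhase_le hθ0 hθ1 hθ2 hθ3 hM)

end UnitFlux

end

end Summit.QuantumFields.BalabanUV.T4Continuum.TorusSmallFieldGlobalGaugeSharpPrep
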